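import Summits.AtomisticToContinuum.BoseEinsteinCondensation.Theorems.BECGroundStateSOSPeriodicIRBoundWFKinematics
import Summits.AtomisticToContinuum.BoseEinsteinCondensation.Theorems.BECGroundStateSOSPeriodicIRBoundWFRegularity
import Literature.MathematicalPhysics.QuantumManyBody.TorusFockLayer
import Literature.MathematicalPhysics.QuantumManyBody.TorusBoseFockLayer
import Summits.AtomisticToContinuum.BoseEinsteinCondensation.Theorems.BECPhaseQuadratureSumRuleDefs
import HarnessLib

/-!
# Route `BECPhaseQuadratureSumRule`, glue `SumRuleChainGlue` (stmt-AtomisticToContinuum-12627) —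
# helper: the per-mode bookkeeping of the c-number split in first quantisation

For a periodic trial state `Ψ` of `N = n + 2` bosons on the torus of side `L`, `Φ = a_0 Ψ` and
`T_p(Ψ) = ‖a_p a_0 Ψ‖²` (`p ∈ ℤ³`): `tsum_pairOcc` (`Σ_p T_p = (N-1) n₀(Ψ)`, Parseval), `pairOcc_zero` (`T_0` is
the pair term `N(N-1)L⁻⁶∫|∫∫Ψ|²` of `CondensateNumberConcentration`), `pairOcc_le_momentumOccupation`
(`T_p ≤ (N-1) n_p(Ψ)`, the ultraviolet handle) and `pairOcc_le_split` (for `p ≠ 0`,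
`T_p ≤ (m₂ + R_A)/‖k‖⁴ + ‖ρ_p†Ψ‖² + R_ρ` with `m₂ = ‖A_pΨ‖²` the current of `CurrentSumRule` and `R_A`, `R_ρ`
the remainders of `NonCondensateRemainders` — `T_p ≤ ‖a_p†Φ‖²` (CCR) `≤ ‖a_p†a_0Ψ‖² + ‖a_0†a_{-p}Ψ‖²` and the
parallelogram law through the quadratures `a_p†a_0 ∓ a_0†a_{-p} = (A - A^{nc})/‖k‖², ρ† - ρ^{nc†}` pointwise).
-/

noncomputable section

open MeasureTheory Filter Complex
open scoped ENNReal NNReal ComplexConjugate BigOperators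

namespace Summit.AtomisticToContinuum.BoseEinsteinCondensation.Theorems.SumRuleChainGlue

open Literature.MathematicalPhysics.QuantumManyBody.BoseGas
open Summit.AtomisticToContinuum.BoseEinsteinCondensation.Cruxes.PeriodicIRBound.LinearPhFloorWagner

variable {n : ℕ} {L : ℝ}

/-- `(cell L).indicator (planeWaveMode L p) = planeWave L p`. -/
theorem indicator_planeWaveMode (L : ℝ) (p : Fin 3 → ℤ) :
    (cell L).indicator (planeWaveMode L p) = planeWave L p := by
  funext x
  by_cases hx : x ∈ cell L
  · simp [planeWave, hx, planeWaveMode_eq]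
  · simp [planeWave, hx]

/-- Occupations of the smooth plane wave are the momentum occupations. -/
theorem cellOccupation_planeWaveMode {M : ℕ} (L : ℝ) (p : Fin 3 → ℤ) (Ψ : Config M → ℂ) :
    cellOccupation M L (planeWaveMode L p) Ψ = momentumOccupation M L p Ψ := by
  rw [momentumOccupation, cellOccupation, cellOccupation, indicator_planeWaveMode, indicator_planeWave]

/-- Bose symmetry moves the annihilated particle into any slot:
`Ψ(x :: X̂ⱼ) = Ψ(update X j x)`. -/
theorem apply_vecCons_removeNth {M : ℕ} {Ψ : Config (M + 1) → ℂ} (hΨ : WF.IsSymm Ψ)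
    (X : Config (M + 1)) (j : Fin (M + 1)) (x : Space) :
    Ψ (Matrix.vecCons x (j.removeNth X)) = Ψ (Function.update X j x) := by
  have h := vecCons_self_removeNth_comp_cycleRange j (Function.update X j x)
  rw [Function.update_self, Fin.removeNth_update] at h
  rw [← hΨ j.cycleRange (Matrix.vecCons x (j.removeNth X)), h]

/-- `(√(L³))⁻¹ · (√(L³))⁻¹ = L⁻³` in `ℂ`. -/
theorem inv_sqrt_mul_inv_sqrt (hL : 0 < L) :
    ((Real.sqrt (L ^ 3) : ℝ) : ℂ)⁻¹ * ((Real.sqrt (L ^ 3) : ℝ) : ℂ)⁻¹ = (((L ^ 3)⁻¹ : ℝ) : ℂ) := by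
  rw [← mul_inv, ← Complex.ofReal_mul, Real.mul_self_sqrt (by positivity), Complex.ofReal_inv]

/-- `a_0 Ψ` through a slot: `(a_0Ψ)(X̂ⱼ) = √(n+2) (√L³)⁻¹ ∫_cell Ψ(update X j y) dy`. -/
theorem condAn_removeNth {Ψ : Config (n + 2) → ℂ} (hΨ : WF.IsSymm Ψ) (X : Config (n + 2)) (j : Fin (n + 2)) :
    condAn L Ψ (j.removeNth X) = ((Real.sqrt (n + 2) : ℝ) : ℂ) *
      (((Real.sqrt (L ^ 3) : ℝ) : ℂ)⁻¹ * ∫ y in cell L, Ψ (Function.update X j y)) := by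
  rw [condAn, modeAn_apply]
  have h : ∀ y : Space, conj (planeWaveMode L 0 y) * Ψ (Matrix.vecCons y (j.removeNth X)) =
      ((Real.sqrt (L ^ 3) : ℝ) : ℂ)⁻¹ * Ψ (Function.update X j y) := by
    intro y
    rw [apply_vecCons_removeNth hΨ, planeWaveMode_eq, cellWave_zero, mul_one, map_inv₀, Complex.conj_ofReal]
  simp_rw [h]
  rw [integral_const_mul]
  push_cast
  ring_nf

/-- `a_q Ψ` through a slot: `(a_qΨ)(X̂ⱼ) = √(n+2) (√L³)⁻¹ ∫_cell e_{-q}(y) Ψ(update X j y) dy`. -/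
theorem modeAn_planeWaveMode_removeNth {Ψ : Config (n + 2) → ℂ} (hΨ : WF.IsSymm Ψ) (q : Fin 3 → ℤ)
    (X : Config (n + 2)) (j : Fin (n + 2)) :
    modeAn L (planeWaveMode L q) Ψ (j.removeNth X) = ((Real.sqrt (n + 2) : ℝ) : ℂ) *
      (((Real.sqrt (L ^ 3) : ℝ) : ℂ)⁻¹ * ∫ y in cell L, cellWave L (-q) y * Ψ (Function.update X j y)) := by
  rw [modeAn_apply]
  have h : ∀ y : Space, conj (planeWaveMode L q y) * Ψ (Matrix.vecCons y (j.removeNth X)) =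
      ((Real.sqrt (L ^ 3) : ℝ) : ℂ)⁻¹ * (cellWave L (-q) y * Ψ (Function.update X j y)) := by
    intro y
    rw [apply_vecCons_removeNth hΨ, planeWaveMode_eq, map_mul, map_inv₀, Complex.conj_ofReal, conj_cellWave,
      mul_assoc]
  simp_rw [h]
  rw [integral_const_mul]
  push_cast
  ring_nf

/-- `√(n+1+1) = √(n+2)` bookkeeping: the normalisation of `a†` on `n+1`-body functions cancels that of `a`
on `n+2`-body functions. -/
theorem sqrt_inv_mul_sqrt (n : ℕ) :
    ((Real.sqrt ((n + 1 : ℕ) + 1) : ℝ) : ℂ)⁻¹ * ((Real.sqrt (n + 2) : ℝ) : ℂ) = 1 := by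
  have h : ((Real.sqrt ((n + 1 : ℕ) + 1) : ℝ) : ℂ) = ((Real.sqrt (n + 2) : ℝ) : ℂ) := by
    push_cast; ring_nf
  rw [h, inv_mul_cancel₀]
  rw [Ne, Complex.ofReal_eq_zero]
  exact (Real.sqrt_pos.mpr (by positivity)).ne'

/-- **`a_p† a_0 Ψ` in first quantisation**: `(a_p†a_0Ψ)(X) = Σⱼ e_p(xⱼ) · L⁻³∫_cell Ψ(update X j y) dy`. -/
theorem modeCr_condAn_apply {Ψ : Config (n + 2) → ℂ} (hΨ : WF.IsSymm Ψ) (hL : 0 < L) (p : Fin 3 → ℤ)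
    (X : Config (n + 2)) :
    modeCr (planeWaveMode L p) (condAn L Ψ) X =
      ∑ j : Fin (n + 2), cellWave L p (X j) * ((((L ^ 3)⁻¹ : ℝ) : ℂ) * ∫ y in cell L, Ψ (Function.update X j y)) := by
  rw [modeCr_apply, Finset.mul_sum]
  refine Finset.sum_congr rfl fun j _ => ?_
  rw [condAn_removeNth hΨ, planeWaveMode_eq, ← inv_sqrt_mul_inv_sqrt hL]
  calc ((Real.sqrt ((n + 1 : ℕ) + 1) : ℝ) : ℂ)⁻¹ * (((Real.sqrt (L ^ 3) : ℝ) : ℂ)⁻¹ * cellWave L p (X j) *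
        (((Real.sqrt (n + 2) : ℝ) : ℂ) * (((Real.sqrt (L ^ 3) : ℝ) : ℂ)⁻¹ * ∫ y in cell L, Ψ (Function.update X j y))))
      = (((Real.sqrt ((n + 1 : ℕ) + 1) : ℝ) : ℂ)⁻¹ * ((Real.sqrt (n + 2) : ℝ) : ℂ)) *
          (cellWave L p (X j) * ((((Real.sqrt (L ^ 3) : ℝ) : ℂ)⁻¹ * ((Real.sqrt (L ^ 3) : ℝ) : ℂ)⁻¹) *
            ∫ y in cell L, Ψ (Function.update X j y))) := by ring
    _ = _ := by rw [sqrt_inv_mul_sqrt, one_mul]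

/-- **`a_0† a_{-p} Ψ` in first quantisation**: `(a_0†a_{-p}Ψ)(X) = Σⱼ L⁻³∫_cell e_p(y) Ψ(update X j y) dy`. -/
theorem modeCr_zero_modeAn_neg_apply {Ψ : Config (n + 2) → ℂ} (hΨ : WF.IsSymm Ψ) (hL : 0 < L) (p : Fin 3 → ℤ)
    (X : Config (n + 2)) :
    modeCr (planeWaveMode L 0) (modeAn L (planeWaveMode L (-p)) Ψ) X =
      ∑ j : Fin (n + 2), (((L ^ 3)⁻¹ : ℝ) : ℂ) * ∫ y in cell L, cellWave L p y * Ψ (Function.update X j y) := by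
  rw [modeCr_apply, Finset.mul_sum]
  refine Finset.sum_congr rfl fun j _ => ?_
  rw [modeAn_planeWaveMode_removeNth hΨ, neg_neg, planeWaveMode_eq, cellWave_zero, mul_one,
    ← inv_sqrt_mul_inv_sqrt hL]
  calc ((Real.sqrt ((n + 1 : ℕ) + 1) : ℝ) : ℂ)⁻¹ * (((Real.sqrt (L ^ 3) : ℝ) : ℂ)⁻¹ *
        (((Real.sqrt (n + 2) : ℝ) : ℂ) * (((Real.sqrt (L ^ 3) : ℝ) : ℂ)⁻¹ *
          ∫ y in cell L, cellWave L p y * Ψ (Function.update X j y))))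
      = (((Real.sqrt ((n + 1 : ℕ) + 1) : ℝ) : ℂ)⁻¹ * ((Real.sqrt (n + 2) : ℝ) : ℂ)) *
          ((((Real.sqrt (L ^ 3) : ℝ) : ℂ)⁻¹ * ((Real.sqrt (L ^ 3) : ℝ) : ℂ)⁻¹) *
            ∫ y in cell L, cellWave L p y * Ψ (Function.update X j y)) := by ring
    _ = _ := by rw [sqrt_inv_mul_sqrt, one_mul]

/-- **The phase quadrature is the c-number current**: pointwise,
`‖k‖² · (a_p†a_0Ψ - a_0†a_{-p}Ψ)(X) = (A_pΨ)(X) - (A_p^{nc}Ψ)(X)`. -/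
theorem currentAmp_sub_currentAmpNc {Ψ : Config (n + 2) → ℂ} (hΨ : WF.IsSymm Ψ) (hL : 0 < L) (p : Fin 3 → ℤ)
    (X : Config (n + 2)) :
    currentAmp L p Ψ X - currentAmpNc L p Ψ X = (((‖kvec L p‖ ^ 2 : ℝ)) : ℂ) *
      (modeCr (planeWaveMode L p) (condAn L Ψ) X - modeCr (planeWaveMode L 0) (modeAn L (planeWaveMode L (-p)) Ψ) X) := by
  rw [modeCr_condAn_apply hΨ hL, modeCr_zero_modeAn_neg_apply hΨ hL, currentAmp, currentAmpNc,
    ← Finset.sum_sub_distrib, ← Finset.sum_sub_distrib, Finset.mul_sum]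
  refine Finset.sum_congr rfl fun j _ => ?_
  ring

/-- **The density quadrature is the c-number density**: pointwise,
`(a_p†a_0Ψ + a_0†a_{-p}Ψ)(X) = (ρ_p†Ψ)(X) - (ρ_p^{nc†}Ψ)(X)`. -/
theorem densityAmp_sub_densityAmpNc {Ψ : Config (n + 2) → ℂ} (hΨ : WF.IsSymm Ψ) (hL : 0 < L) (p : Fin 3 → ℤ)
    (X : Config (n + 2)) :
    densityAmp L p Ψ X - densityAmpNc L p Ψ X =
      modeCr (planeWaveMode L p) (condAn L Ψ) X + modeCr (planeWaveMode L 0) (modeAn L (planeWaveMode L (-p)) Ψ) X := by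
  rw [modeCr_condAn_apply hΨ hL, modeCr_zero_modeAn_neg_apply hΨ hL, densityAmp, densityAmpNc,
    ← Finset.sum_sub_distrib, ← Finset.sum_add_distrib]
  refine Finset.sum_congr rfl fun j _ => ?_
  ring

section Regularity

variable (hL : 0 < L) (Ψ : PeriodicTrialState (n + 2) L)
include hL

/-- `a_0Ψ` is a core function (`C¹`, periodic, Bose-symmetric). -/
theorem isCore_condAn : WF.IsCore L (condAn L Ψ.ψ) :=
  WF.isCore_modeAn hL 0 (WF.isCore_trialState Ψ)

/-- `a_0Ψ` is continuous. -/
theorem continuous_condAn : Continuous (condAn L Ψ.ψ) :=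
  (isCore_condAn hL Ψ).contDiff.continuous

/-- `‖a_0Ψ‖² = n₀(Ψ)`. -/
theorem normSq_condAn : WF.normSq L (condAn L Ψ.ψ) = condensateOccupation (n + 2) L Ψ.ψ := by
  rw [condAn, WF.normSq_modeAn hL, cellOccupation_planeWaveMode, momentumOccupation_zero]

/-- `T_p = n_p(a_0Ψ)`, the momentum occupation of the `(N-1)`-body function `a_0Ψ`. -/
theorem pairOcc_eq_cellOccupation (p : Fin 3 → ℤ) :
    pairOcc L p Ψ.ψ = cellOccupation (n + 1) L (planeWaveMode L p) (condAn L Ψ.ψ) := by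
  show WF.normSq L (modeAn L (planeWaveMode L p) (condAn L Ψ.ψ)) = _
  rw [WF.normSq_modeAn hL]

end Regularity

/-- **`Σ_p T_p(Ψ) = (N - 1) · n₀(Ψ)`**: Parseval for the `(N-1)`-body function `a_0Ψ`, whose norm is `n₀(Ψ)`. -/
theorem tsum_pairOcc (hL : 0 < L) (Ψ : PeriodicTrialState (n + 2) L) :
    ∑' p, pairOcc L p Ψ.ψ = ((n + 1 : ℕ) : ℝ≥0∞) * condensateOccupation (n + 2) L Ψ.ψ := by
  simp only [pairOcc_eq_cellOccupation hL Ψ]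
  rw [tsum_cellOccupation_planeWaveMode_eq hL (continuous_condAn hL Ψ), ← normSq_condAn hL Ψ, WF.normSq]

/-- **`T_0 = N(N-1) L⁻⁶ ∫_{cell^{N-2}} |∫∫ Ψ(x, y, ·) dx dy|²`** (two annihilations of the constant mode,
`modeAn_modeAn_apply`, and Bose symmetry to order the two integrations as in the route's statement). -/
theorem pairOcc_zero (hL : 0 < L) (Ψ : PeriodicTrialState (n + 2) L) :
    pairOcc L 0 Ψ.ψ = ((n + 2 : ℕ) : ℝ≥0∞) * ((n + 1 : ℕ) : ℝ≥0∞) *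
      (∫⁻ Y in cellN n L, (‖∫ x in cell L, ∫ y in cell L,
        Ψ.ψ (Matrix.vecCons x (Matrix.vecCons y Y))‖₊ : ℝ≥0∞) ^ 2) / ENNReal.ofReal (L ^ 6) := by
  have hL3 : 0 < L ^ 3 := by positivity
  have hL6 : 0 < L ^ 6 := by positivity
  rw [pairOcc, condAn]
  -- the integrand
  have hpt : ∀ Y : Config n, modeAn L (planeWaveMode L 0) (modeAn L (planeWaveMode L 0) Ψ.ψ) Y =
      (((Real.sqrt ((n + 2) * (n + 1)) : ℝ) : ℂ) * (((L ^ 3)⁻¹ : ℝ) : ℂ)) *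
        ∫ x in cell L, ∫ y in cell L, Ψ.ψ (Matrix.vecCons x (Matrix.vecCons y Y)) := by
    intro Y
    rw [modeAn_modeAn_apply]
    have h1 : ∀ y x : Space, conj (planeWaveMode L 0 y) * conj (planeWaveMode L 0 x) *
        Ψ.ψ (Matrix.vecCons x (Matrix.vecCons y Y)) =
        (((L ^ 3)⁻¹ : ℝ) : ℂ) * Ψ.ψ (Matrix.vecCons y (Matrix.vecCons x Y)) := by
      intro y x
      rw [show planeWaveMode L 0 y = _ from planeWaveMode_eq L 0 y,
        show planeWaveMode L 0 x = _ from planeWaveMode_eq L 0 x]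
      simp only [cellWave_zero, mul_one, map_inv₀, Complex.conj_ofReal]
      rw [inv_sqrt_mul_inv_sqrt hL, ← Ψ.symm (Equiv.swap 0 1) (Matrix.vecCons x (Matrix.vecCons y Y)),
        vecCons_vecCons_comp_swap]
    simp_rw [h1]
    simp_rw [integral_const_mul]
    rw [← mul_assoc]
  simp_rw [hpt, nnnorm_mul, ENNReal.coe_mul, mul_pow]
  have htop : ((‖((Real.sqrt ((n + 2) * (n + 1)) : ℝ) : ℂ)‖₊ : ℝ≥0∞) ^ 2 *
      (‖(((L ^ 3)⁻¹ : ℝ) : ℂ)‖₊ : ℝ≥0∞) ^ 2) ≠ ⊤ :=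
    ENNReal.mul_ne_top (ENNReal.pow_ne_top ENNReal.coe_ne_top) (ENNReal.pow_ne_top ENNReal.coe_ne_top)
  rw [lintegral_const_mul' _ _ htop]
  -- the constant
  have hc : ((‖((Real.sqrt ((n + 2) * (n + 1)) : ℝ) : ℂ)‖₊ : ℝ≥0∞) ^ 2 *
      (‖(((L ^ 3)⁻¹ : ℝ) : ℂ)‖₊ : ℝ≥0∞) ^ 2) =
      ((n + 2 : ℕ) : ℝ≥0∞) * ((n + 1 : ℕ) : ℝ≥0∞) * (ENNReal.ofReal (L ^ 6))⁻¹ := by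
    rw [coe_nnnorm_sq_eq_ofReal, coe_nnnorm_sq_eq_ofReal, Complex.norm_real, Complex.norm_real,
      Real.norm_of_nonneg (Real.sqrt_nonneg _), Real.norm_of_nonneg (by positivity), Real.sq_sqrt (by positivity),
      ← ENNReal.ofReal_inv_of_pos hL6, show ((L ^ 3)⁻¹ : ℝ) ^ 2 = (L ^ 6)⁻¹ by rw [inv_pow]; ring,
      ENNReal.ofReal_mul (by positivity)]
    congr 1
    rw [show ((n : ℝ) + 2) = ((n + 2 : ℕ) : ℝ) by push_cast; ring, show ((n : ℝ) + 1) = ((n + 1 : ℕ) : ℝ) by push_cast; ring,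
      ENNReal.ofReal_natCast, ENNReal.ofReal_natCast]
  rw [hc, ENNReal.div_eq_inv_mul]
  ring

/-- **`T_p(Ψ) ≤ (N - 1) n_p(Ψ)`**: `a_p a_0 = a_0 a_p` (CCR), and `‖a_0 Θ‖² ≤ (N-1)‖Θ‖²` for the
`(N-1)`-body function `Θ = a_pΨ`, whose norm is `n_p(Ψ)`. -/
theorem pairOcc_le_momentumOccupation (hL : 0 < L) (Ψ : PeriodicTrialState (n + 2) L) (p : Fin 3 → ℤ) :
    pairOcc L p Ψ.ψ ≤ ((n + 1 : ℕ) : ℝ≥0∞) * momentumOccupation (n + 2) L p Ψ.ψ := by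
  have hcomm : modeAn L (planeWaveMode L p) (condAn L Ψ.ψ) =
      modeAn L (planeWaveMode L 0) (modeAn L (planeWaveMode L p) Ψ.ψ) :=
    modeAn_modeAn_comm (L := L) (continuous_planeWaveMode L p).measurable (continuous_planeWaveMode L 0).measurable
      (fun x => (norm_planeWaveMode L p x).le) (fun x => (norm_planeWaveMode L 0 x).le) Ψ.contDiff.continuous Ψ.symm
  show WF.normSq L (modeAn L (planeWaveMode L p) (condAn L Ψ.ψ)) ≤ _
  rw [hcomm, WF.normSq_modeAn hL]
  refine (WF.cellOccupation_le_mul_normSq hL 0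
    (WF.continuous_modeAn L (continuous_planeWaveMode L p) Ψ.contDiff.continuous)).trans ?_
  rw [WF.normSq_modeAn hL, cellOccupation_planeWaveMode]

/-- `latticeVec 1 p ≠ 0` for `p ≠ 0`. -/
theorem norm_kvec_pos (hL : 0 < L) {p : Fin 3 → ℤ} (hp : p ≠ 0) : 0 < ‖kvec L p‖ := by
  rw [kvec, norm_smul, Real.norm_of_nonneg (by positivity)]
  refine mul_pos (by positivity) (norm_pos_iff.2 fun h => hp ?_)
  funext j
  have := congrArg (fun x : Space => x j) h
  simpa [latticeVec] using this

/-- Slot integrals of a continuous function against a continuous weight are measurable in the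
remaining variables. -/
theorem measurable_slotIntegral {M : ℕ} {Ψ : Config M → ℂ} (hΨ : Continuous Ψ) {g : Space → ℂ}
    (hg : Continuous g) (j : Fin M) :
    Measurable fun X : Config M => ∫ y in cell L, g y * Ψ (Function.update X j y) := by
  have h : StronglyMeasurable
      (Function.uncurry fun (X : Config M) (y : Space) => g y * Ψ (Function.update X j y)) := by
    refine Continuous.stronglyMeasurable ?_
    exact (hg.comp continuous_snd).mul (hΨ.comp (continuous_fst.update j continuous_snd))
  exact (h.integral_prod_right' (ν := volume.restrict (cell L))).measurable

/-- The current amplitude is measurable. -/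
theorem measurable_currentAmp (p : Fin 3 → ℤ) (Ψ : PeriodicTrialState (n + 2) L) :
    Measurable (currentAmp L p Ψ.ψ) := by
  refine Finset.measurable_sum _ fun j _ => ?_
  refine ((continuous_cellWave L p).measurable.comp (measurable_pi_apply j)).mul ?_
  refine (measurable_const.mul ?_).add (measurable_const.mul Ψ.contDiff.continuous.measurable)
  exact ((Ψ.contDiff.continuous_fderiv one_ne_zero).clm_apply continuous_const).measurable

/-- The non-condensate current amplitude is measurable. -/
theorem measurable_currentAmpNc (p : Fin 3 → ℤ) (Ψ : PeriodicTrialState (n + 2) L) :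
    Measurable (currentAmpNc L p Ψ.ψ) := by
  have hΨc := Ψ.contDiff.continuous
  refine Finset.measurable_sum _ fun j _ => ?_
  refine (((continuous_cellWave L p).measurable.comp (measurable_pi_apply j)).mul ?_).add ?_
  · refine (measurable_const.mul ?_).add (measurable_const.mul (hΨc.measurable.sub (measurable_const.mul ?_)))
    · exact ((Ψ.contDiff.continuous_fderiv one_ne_zero).clm_apply continuous_const).measurable
    · have h := measurable_slotIntegral (L := L) hΨc continuous_const j (g := fun _ => (1 : ℂ))
      simpa using h
  · exact measurable_const.mul (measurable_const.mul (measurable_slotIntegral hΨc (continuous_cellWave L p) j))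

/-- The density amplitude is measurable. -/
theorem measurable_densityAmp (p : Fin 3 → ℤ) (Ψ : PeriodicTrialState (n + 2) L) :
    Measurable (densityAmp L p Ψ.ψ) :=
  Finset.measurable_sum _ fun j _ =>
    ((continuous_cellWave L p).measurable.comp (measurable_pi_apply j)).mul Ψ.contDiff.continuous.measurable

/-- Pointwise parallelogram bound behind the split: for complex numbers with `a - b = c⁻¹(A - A')`,
`a + b = D - D'` and `c > 0`,
`‖a‖² ≤ ‖a‖² + ‖b‖² ≤ c⁻²(‖A‖² + ‖A'‖²) + ‖D‖² + ‖D'‖²`. -/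
theorem normSq_le_of_quadratures {a b A A' D D' : ℂ} {c : ℝ} (hc : 0 < c)
    (h1 : A - A' = (c : ℂ) * (a - b)) (h2 : D - D' = a + b) :
    ((‖a‖₊ : ℝ≥0∞) ^ 2) ≤ ENNReal.ofReal ((c ^ 2)⁻¹) * (((‖A‖₊ : ℝ≥0∞) ^ 2) + ((‖A'‖₊ : ℝ≥0∞) ^ 2)) +
      ((‖D‖₊ : ℝ≥0∞) ^ 2) + ((‖D'‖₊ : ℝ≥0∞) ^ 2) := by
  simp only [coe_nnnorm_sq_eq_ofReal]
  rw [← ENNReal.ofReal_add (by positivity) (by positivity), ← ENNReal.ofReal_mul (by positivity),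
    ← ENNReal.ofReal_add (by positivity) (by positivity), ← ENNReal.ofReal_add (by positivity) (by positivity)]
  refine ENNReal.ofReal_le_ofReal ?_
  have hpar := parallelogram_law_with_norm ℝ a b
  have hab : ‖a - b‖ = c⁻¹ * ‖A - A'‖ := by
    rw [h1, norm_mul, Complex.norm_real, Real.norm_of_nonneg hc.le]
    field_simp
  have hAA : ‖A - A'‖ ^ 2 ≤ 2 * (‖A‖ ^ 2 + ‖A'‖ ^ 2) := by
    have := parallelogram_law_with_norm ℝ A A'
    nlinarith [norm_nonneg (A + A')]
  have hDD : ‖D - D'‖ ^ 2 ≤ 2 * (‖D‖ ^ 2 + ‖D'‖ ^ 2) := by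
    have := parallelogram_law_with_norm ℝ D D'
    nlinarith [norm_nonneg (D + D')]
  rw [h2] at hDD
  have hsub : ‖a - b‖ ^ 2 ≤ (c ^ 2)⁻¹ * (2 * (‖A‖ ^ 2 + ‖A'‖ ^ 2)) := by
    rw [hab, mul_pow, ← inv_pow]
    exact mul_le_mul_of_nonneg_left hAA (by positivity)
  nlinarith [norm_nonneg b, sq_nonneg ‖b‖]

/-- **The infrared handle.** For `p ≠ 0`,
`T_p(Ψ) ≤ (‖A_pΨ‖² + ‖A_p^{nc}Ψ‖²)/‖k‖⁴ + ‖ρ_p†Ψ‖² + ‖ρ_p^{nc†}Ψ‖²`: `T_p ≤ ‖Φ‖² + T_p = ‖a_p†Φ‖²`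
(`Φ = a_0Ψ`, CCR), add `‖a_0†a_{-p}Ψ‖² ≥ 0`, and bound pointwise by the parallelogram law through the
two quadratures `a_p†a_0 ∓ a_0†a_{-p}`, which are `(A - A^{nc})/‖k‖²` and `ρ† - ρ^{nc†}`. -/
theorem pairOcc_le_split (hL : 0 < L) (Ψ : PeriodicTrialState (n + 2) L) {p : Fin 3 → ℤ} (hp : p ≠ 0) :
    pairOcc L p Ψ.ψ ≤
      ((∫⁻ X in cellN (n + 2) L, (‖currentAmp L p Ψ.ψ X‖₊ : ℝ≥0∞) ^ 2) +
          ∫⁻ X in cellN (n + 2) L, (‖currentAmpNc L p Ψ.ψ X‖₊ : ℝ≥0∞) ^ 2) / ENNReal.ofReal (‖kvec L p‖ ^ 4) +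
        (∫⁻ X in cellN (n + 2) L, (‖densityAmp L p Ψ.ψ X‖₊ : ℝ≥0∞) ^ 2) +
        ∫⁻ X in cellN (n + 2) L, (‖densityAmpNc L p Ψ.ψ X‖₊ : ℝ≥0∞) ^ 2 := by
  have hk := norm_kvec_pos hL hp
  have hk2 : 0 < ‖kvec L p‖ ^ 2 := by positivity
  set a : Config (n + 2) → ℂ := modeCr (planeWaveMode L p) (condAn L Ψ.ψ) with ha
  set b : Config (n + 2) → ℂ := modeCr (planeWaveMode L 0) (modeAn L (planeWaveMode L (-p)) Ψ.ψ) with hb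
  -- `T_p ≤ ‖a_p† Φ‖²`
  have h1 : pairOcc L p Ψ.ψ ≤ WF.normSq L a := by
    rw [pairOcc_eq_cellOccupation hL, ha, WF.normSq_modeCr hL p (isCore_condAn hL Ψ)]
    exact le_add_self
  refine h1.trans ?_
  -- pointwise bound
  have hpt : ∀ X, ((‖a X‖₊ : ℝ≥0∞) ^ 2) ≤
      ENNReal.ofReal (((‖kvec L p‖ ^ 2) ^ 2)⁻¹) * (((‖currentAmp L p Ψ.ψ X‖₊ : ℝ≥0∞) ^ 2) +
        ((‖currentAmpNc L p Ψ.ψ X‖₊ : ℝ≥0∞) ^ 2)) +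
        ((‖densityAmp L p Ψ.ψ X‖₊ : ℝ≥0∞) ^ 2) + ((‖densityAmpNc L p Ψ.ψ X‖₊ : ℝ≥0∞) ^ 2) := fun X =>
    normSq_le_of_quadratures hk2 (by rw [currentAmp_sub_currentAmpNc Ψ.symm hL p X])
      (densityAmp_sub_densityAmpNc Ψ.symm hL p X)
  refine (lintegral_mono hpt).trans (le_of_eq ?_)
  have hmA : Measurable fun X => ((‖currentAmp L p Ψ.ψ X‖₊ : ℝ≥0∞) ^ 2) :=
    (measurable_currentAmp p Ψ).nnnorm.coe_nnreal_ennreal.pow_const _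
  have hmA' : Measurable fun X => ((‖currentAmpNc L p Ψ.ψ X‖₊ : ℝ≥0∞) ^ 2) :=
    (measurable_currentAmpNc p Ψ).nnnorm.coe_nnreal_ennreal.pow_const _
  have hmD : Measurable fun X => ((‖densityAmp L p Ψ.ψ X‖₊ : ℝ≥0∞) ^ 2) :=
    (measurable_densityAmp p Ψ).nnnorm.coe_nnreal_ennreal.pow_const _
  have hS : Measurable fun X => ((‖currentAmp L p Ψ.ψ X‖₊ : ℝ≥0∞) ^ 2) +
      ((‖currentAmpNc L p Ψ.ψ X‖₊ : ℝ≥0∞) ^ 2) := hmA.add hmA'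
  have hF2 : Measurable fun X => ENNReal.ofReal (((‖kvec L p‖ ^ 2) ^ 2)⁻¹) *
      (((‖currentAmp L p Ψ.ψ X‖₊ : ℝ≥0∞) ^ 2) + ((‖currentAmpNc L p Ψ.ψ X‖₊ : ℝ≥0∞) ^ 2)) := hS.const_mul _
  have hF1 : Measurable fun X => ENNReal.ofReal (((‖kvec L p‖ ^ 2) ^ 2)⁻¹) *
      (((‖currentAmp L p Ψ.ψ X‖₊ : ℝ≥0∞) ^ 2) + ((‖currentAmpNc L p Ψ.ψ X‖₊ : ℝ≥0∞) ^ 2)) +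
      ((‖densityAmp L p Ψ.ψ X‖₊ : ℝ≥0∞) ^ 2) := hF2.add hmD
  rw [lintegral_add_left hF1, lintegral_add_left hF2, lintegral_const_mul _ hS, lintegral_add_left hmA,
    ENNReal.div_eq_inv_mul, ← ENNReal.ofReal_inv_of_pos (by positivity)]
  congr 3
  ring

end Summit.AtomisticToContinuum.BoseEinsteinCondensation.Theorems.SumRuleChainGlue

end
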